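import Summits.CriticalPhenomena.PercolationContinuityZ3.Theorems.PercNearOneGluingNoHeavyLowerTailThreePointProductFormFibreTerminalNetwork
import Summits.CriticalPhenomena.PercolationContinuityZ3.Theorems.PercNearOneGluingNoHeavyLowerTailThreePointProductFormFibreTwoTerminal
import HarnessLib

/-!
# The product form in the fibre language: the inequality (S1J) `(#bad + w)² ≤ #P1·#J` is INVARIANT under terminal networks
# (Sahi programme, prover prim-sahi-p2 gen 56)

Support file (`--supports stmt-CriticalPhenomena-4575`, helper); continues `…ThreePointProductFormFibreTerminalNetwork` (gen 55: reduction R3,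
`productForm_of_terminalNetwork`) and `…FibreTwoTerminal` (`V + A = Cn`).  Standard axioms, no sorries, no named facts, no definitions.
Memo `run/shared/lean/prim/prim-sahi/FROM-prim-sahi-p2-gen56-REFINED-PRODUCT-FORM.md` §10; PROOF-E3 (66i).

SETTING of R3: a cut vertex `u` separates the network side `W ∋ s` from the rest `∌ a, c`; `H'` = the far side with terminals `(u, a, c)`.
With `w := #{z ∈ P1 : s ↔ c in ♭z}` (gen 55) and the network counts `Cn = #{u ↔ s}`, `Vn`, `A = #{u ↔ s in z and in ♭_u z}`:
* `w_iff_network` [this work] — pointwise `w(H) = A-event ∩ Wt`, `Wt = {a ↔ u, a ↮ c, u ↔ c in ♭z}` (the far `w`); `joined_iff_network`: `J(H) = {u↔s} ∩ J'`.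
* **`S1J_of_terminalNetwork`** [this work] — `(S1J)` TRANSFERS EXACTLY: if `(#bad′ + w′)² ≤ #P1′ · #J′` on the far side `(u, a, c)` then
  `(#bad + w)² ≤ #P1 · #J` on `H` for `(s, a, c)` — because `#bad + w = Cn·(bad′ + w′)` (`bad = Cn·bad′ + Vn·w′`, `w = A·w′`, `Vn + A = Cn`),
  `#P1 = Cn·#P1′`, `#J = Cn·#J′`.
* **`productForm_of_terminalNetwork_of_S1J`** [this work] — `(P)(H′) ∧ (S1J)(H′) ⟹ (P)(H)`: the second hypothesis of
  `productForm_of_terminalNetwork` ((P) for the far side with a pendant label) follows from `(S1J)(H′)` since `#J′ ≤ 2#P2′ + #J′`.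
So for the SYSTEM `𝒮 = {(P), (S1J), (S1J)′}` (all 0 exceptions on 5.9·10⁹ instances, gen 56 census), terminal networks — in particular single
pendant terminal labels — are reducible: a minimal counterexample to `𝒮` is 2-connected (memo §10).  [folklore] (product counting across a cut vertex);
[cite: Gladkov2024, Conjecture 10.1 (p. 18), arXiv:2408.08457] for CONJECTURE (P) served.
-/

namespace Summit.CriticalPhenomena.PercolationContinuityZ3.Theorems.ProductFormFibre

open Finset Literature.Probability.Percolation
open Summit.CriticalPhenomena.PercolationContinuityZ3.Theorems.ThreePointCPIClusterSwap (clusterFlip)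

variable {V α : Type*}

section PointwiseS1J

variable (ends : α → Sym2 V) (u : V) (W : Set V) [DecidableEq V]

/-- **`J(H) = {u ↔ s} ∩ J′` pointwise** (`s ∈ W`, `a, c ∉ W`). [this work] -/
theorem joined_iff_network
    (hsep : ∀ l : α, (∀ v ∈ ends l, v ∈ W ∨ v = u) ∨ (∀ v ∈ ends l, v ∉ W ∨ v = u)) (huW : u ∉ W)
    {a s c : V} (hs : s ∈ W) (haW : a ∉ W) (z : α → Bool) :
    ((openGraph (labelledOpen ends z)).Reachable a s ∧ (openGraph (labelledOpen ends z)).Reachable a c) ↔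
    ((openGraph (labelledOpen ends z)).Reachable u s ∧
      ((openGraph (labelledOpen ends z)).Reachable a u ∧ (openGraph (labelledOpen ends z)).Reachable a c)) := by
  have cut_a := reachable_cut_iff ends u W hsep huW z hs haW
  refine ⟨fun ⟨has, hac⟩ => ⟨(cut_a.1 has.symm).1.symm, (cut_a.1 has.symm).2.symm, hac⟩,
    fun ⟨hus, hau, hac⟩ => ⟨hau.trans hus, hac⟩⟩

/-- **`w(H) = A ∩ Wt` pointwise**: `a ↔ s, a ↮ c, s ↔ c in ♭z` iff (`u ↔ s` in `z` and in `♭_u z`) and (`a ↔ u, a ↮ c, u ↔ c in ♭_a z`). [this work] -/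
theorem w_iff_network
    (hsep : ∀ l : α, (∀ v ∈ ends l, v ∈ W ∨ v = u) ∨ (∀ v ∈ ends l, v ∉ W ∨ v = u)) (huW : u ∉ W)
    {a s c : V} (hs : s ∈ W) (haW : a ∉ W) (hcW : c ∉ W) (z : α → Bool) :
    (((openGraph (labelledOpen ends z)).Reachable a s ∧ ¬ (openGraph (labelledOpen ends z)).Reachable a c) ∧
      (openGraph (labelledOpen ends (clusterFlip ends a fun x => !z x))).Reachable s c) ↔
    (((openGraph (labelledOpen ends z)).Reachable u s ∧
        (openGraph (labelledOpen ends (clusterFlip ends u fun x => !z x))).Reachable u s) ∧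
      (((openGraph (labelledOpen ends z)).Reachable a u ∧ ¬ (openGraph (labelledOpen ends z)).Reachable a c) ∧
        (openGraph (labelledOpen ends (clusterFlip ends a fun x => !z x))).Reachable u c)) := by
  have cut_a := reachable_cut_iff ends u W hsep huW z hs haW
  have cut_c' := reachable_cut_iff ends u W hsep huW (clusterFlip ends a fun x => !z x) hs hcW
  constructor
  · rintro ⟨⟨has, hac⟩, hf⟩
    obtain ⟨hsu, hua⟩ := cut_a.1 has.symm
    have hflat := flat_eq_flat_of_reachable ends z hua.symm
    obtain ⟨hfsu, hfuc⟩ := cut_c'.1 hf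
    refine ⟨⟨hsu.symm, ?_⟩, ⟨hua.symm, hac⟩, hfuc⟩
    rw [← hflat]; exact hfsu.symm
  · rintro ⟨⟨hus, hfus⟩, ⟨hau, hac⟩, hfuc⟩
    have hflat := flat_eq_flat_of_reachable ends z hau
    refine ⟨⟨hau.trans hus, hac⟩, ?_⟩
    have hfsu : (openGraph (labelledOpen ends (clusterFlip ends a fun x => !z x))).Reachable s u := by
      rw [hflat]; exact hfus.symm
    exact hfsu.trans hfuc

end PointwiseS1J

section CountsS1J

variable [Fintype α] [DecidableEq α] [DecidableEq V]

open Classical in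
/-- **(S1J) TRANSFERS EXACTLY THROUGH A TERMINAL NETWORK.**  In the setting of R3 (`u ∉ W` separates `W ∋ s` from the rest, `a, c ∉ W`,
`a ≠ u`, `c ≠ u`): if the far side satisfies `(S1J)` for `(u, a, c)`, i.e. `(#bad′ + w′)² ≤ #P1′ · #J′`, then `(#bad + w)² ≤ #P1 · #J` for
`(s, a, c)`.  (`#bad + w = Cn·(#bad′ + w′)` by `Vn + A = Cn`; `#P1 = Cn·#P1′`; `#J = Cn·#J′`.) [this work] -/
theorem S1J_of_terminalNetwork (ends : α → Sym2 V) (u a s c : V) (W : Set V)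
    (hsep : ∀ l : α, (∀ v ∈ ends l, v ∈ W ∨ v = u) ∨ (∀ v ∈ ends l, v ∉ W ∨ v = u))
    (huW : u ∉ W) (hs : s ∈ W) (haW : a ∉ W) (hau : a ≠ u) (hcW : c ∉ W) (hcu : c ≠ u)
    (h : ((univ.filter fun z : α → Bool =>
        (¬ (openGraph (labelledOpen ends z)).Reachable a u ∧ ¬ (openGraph (labelledOpen ends z)).Reachable a c ∧
            ¬ (openGraph (labelledOpen ends z)).Reachable u c) ∧
          (openGraph (labelledOpen ends (clusterFlip ends a fun x => !z x))).Reachable u c).card +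
        (univ.filter fun z : α → Bool =>
          ((openGraph (labelledOpen ends z)).Reachable a u ∧ ¬ (openGraph (labelledOpen ends z)).Reachable a c) ∧
            (openGraph (labelledOpen ends (clusterFlip ends a fun x => !z x))).Reachable u c).card) ^ 2 ≤
      (univ.filter fun z : α → Bool =>
        (openGraph (labelledOpen ends z)).Reachable a u ∧ ¬ (openGraph (labelledOpen ends z)).Reachable a c).card *
      (univ.filter fun z : α → Bool =>
        (openGraph (labelledOpen ends z)).Reachable a u ∧ (openGraph (labelledOpen ends z)).Reachable a c).card) :
    ((univ.filter fun z : α → Bool =>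
        (¬ (openGraph (labelledOpen ends z)).Reachable a s ∧ ¬ (openGraph (labelledOpen ends z)).Reachable a c ∧
            ¬ (openGraph (labelledOpen ends z)).Reachable s c) ∧
          (openGraph (labelledOpen ends (clusterFlip ends a fun x => !z x))).Reachable s c).card +
      (univ.filter fun z : α → Bool =>
        ((openGraph (labelledOpen ends z)).Reachable a s ∧ ¬ (openGraph (labelledOpen ends z)).Reachable a c) ∧
          (openGraph (labelledOpen ends (clusterFlip ends a fun x => !z x))).Reachable s c).card) ^ 2 ≤
    (univ.filter fun z : α → Bool =>
        (openGraph (labelledOpen ends z)).Reachable a s ∧ ¬ (openGraph (labelledOpen ends z)).Reachable a c).card *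
    (univ.filter fun z : α → Bool =>
        (openGraph (labelledOpen ends z)).Reachable a s ∧ (openGraph (labelledOpen ends z)).Reachable a c).card := by
  set T : Set V := {v : V | v ∉ W ∧ v ≠ u} with hT
  have hsepT := separates_compl ends u W hsep
  have huT : u ∉ T := fun h' => h'.2 rfl
  have haT : a ∈ T ∨ a = u := Or.inl ⟨haW, hau⟩
  have hcT : c ∈ T ∨ c = u := Or.inl ⟨hcW, hcu⟩
  have huT' : u ∈ T ∨ u = u := Or.inr rfl
  let ins : α → Prop := fun l => (∀ v ∈ ends l, v ∈ W ∨ v = u) ∧ ¬ (ends l).IsDiag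
  have hagW : ∀ z z' : α → Bool, (∀ l, ins l → z l = z' l) →
      ∀ l, (∀ v ∈ ends l, v ∈ W ∨ v = u) → ¬ (ends l).IsDiag → z l = z' l :=
    fun z z' h l hl hd => h l ⟨hl, hd⟩
  have hagT : ∀ z z' : α → Bool, (∀ l, ¬ ins l → z l = z' l) →
      ∀ l, (∀ v ∈ ends l, v ∈ T ∨ v = u) → ¬ (ends l).IsDiag → z l = z' l := by
    intro z z' h l hl hd
    refine h l fun hins => hd (isDiag_of_forall_eq (a := u) fun v hv => ?_)
    rcases hins.1 v hv with h1 | h1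
    · rcases hl v hv with h2 | h2
      · exact absurd h1 h2.1
      · exact h2
    · exact h1
  -- locality of the network-side and far-side events
  have hR_in : ∀ z z' : α → Bool, (∀ l, ins l → z l = z' l) →
      ((openGraph (labelledOpen ends z)).Reachable u s ↔ (openGraph (labelledOpen ends z')).Reachable u s) :=
    fun z z' h => reachable_iff_of_agree_inside ends u W hsep huW (hagW z z' h) (Or.inl hs)
  have hF_in : ∀ z z' : α → Bool, (∀ l, ins l → z l = z' l) →
      ((openGraph (labelledOpen ends (clusterFlip ends u fun x => !z x))).Reachable u s ↔
        (openGraph (labelledOpen ends (clusterFlip ends u fun x => !z' x))).Reachable u s) :=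
    fun z z' h => reachable_iff_of_agree_inside ends u W hsep huW
      (z := clusterFlip ends u fun x => !z x) (z' := clusterFlip ends u fun x => !z' x)
      (fun l hl hd => flat_apply_eq_of_agree ends u W hsep huW (hagW z z' h) hl hd) (Or.inl hs)
  have hV_in : ∀ z z' : α → Bool, (∀ l, ins l → z l = z' l) →
      (¬ (openGraph (labelledOpen ends z)).Reachable u s ∧
          (openGraph (labelledOpen ends (clusterFlip ends u fun x => !z x))).Reachable u s) →
      (¬ (openGraph (labelledOpen ends z')).Reachable u s ∧
          (openGraph (labelledOpen ends (clusterFlip ends u fun x => !z' x))).Reachable u s) :=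
    fun z z' h hz => ⟨fun h' => hz.1 ((hR_in z z' h).2 h'), (hF_in z z' h).1 hz.2⟩
  have hA_in : ∀ z z' : α → Bool, (∀ l, ins l → z l = z' l) →
      ((openGraph (labelledOpen ends z)).Reachable u s ∧
          (openGraph (labelledOpen ends (clusterFlip ends u fun x => !z x))).Reachable u s) →
      ((openGraph (labelledOpen ends z')).Reachable u s ∧
          (openGraph (labelledOpen ends (clusterFlip ends u fun x => !z' x))).Reachable u s) :=
    fun z z' h hz => ⟨(hR_in z z' h).1 hz.1, (hF_in z z' h).1 hz.2⟩
  have hR_out : ∀ z z' : α → Bool, (∀ l, ¬ ins l → z l = z' l) → ∀ {x y : V}, (x ∈ T ∨ x = u) → (y ∈ T ∨ y = u) →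
      ((openGraph (labelledOpen ends z)).Reachable x y ↔ (openGraph (labelledOpen ends z')).Reachable x y) :=
    fun z z' h x y hx hy => reachable_iff_of_agree_outside ends u W hsep huW (hagT z z' h) hx hy
  have hF_out : ∀ z z' : α → Bool, (∀ l, ¬ ins l → z l = z' l) →
      ((openGraph (labelledOpen ends (clusterFlip ends a fun x => !z x))).Reachable u c ↔
        (openGraph (labelledOpen ends (clusterFlip ends a fun x => !z' x))).Reachable u c) :=
    fun z z' h => reachable_iff_of_agree_outside ends u W hsep huW
      (fun l hl hd => flat_apply_eq_of_agree_outside ends u W hsep huW (hagT z z' h) haT hl hd) huT' hcT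
  have hWt_out : ∀ z z' : α → Bool, (∀ l, ¬ ins l → z l = z' l) →
      (((openGraph (labelledOpen ends z)).Reachable a u ∧ ¬ (openGraph (labelledOpen ends z)).Reachable a c) ∧
          (openGraph (labelledOpen ends (clusterFlip ends a fun x => !z x))).Reachable u c) →
      (((openGraph (labelledOpen ends z')).Reachable a u ∧ ¬ (openGraph (labelledOpen ends z')).Reachable a c) ∧
          (openGraph (labelledOpen ends (clusterFlip ends a fun x => !z' x))).Reachable u c) := by
    rintro z z' h ⟨⟨e1, e2⟩, e4⟩
    exact ⟨⟨(hR_out z z' h haT huT').1 e1, fun h' => e2 ((hR_out z z' h haT hcT).2 h')⟩, (hF_out z z' h).1 e4⟩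
  have hB_out : ∀ z z' : α → Bool, (∀ l, ¬ ins l → z l = z' l) →
      ((¬ (openGraph (labelledOpen ends z)).Reachable a u ∧ ¬ (openGraph (labelledOpen ends z)).Reachable a c ∧
            ¬ (openGraph (labelledOpen ends z)).Reachable u c) ∧
          (openGraph (labelledOpen ends (clusterFlip ends a fun x => !z x))).Reachable u c) →
      ((¬ (openGraph (labelledOpen ends z')).Reachable a u ∧ ¬ (openGraph (labelledOpen ends z')).Reachable a c ∧
            ¬ (openGraph (labelledOpen ends z')).Reachable u c) ∧
          (openGraph (labelledOpen ends (clusterFlip ends a fun x => !z' x))).Reachable u c) := by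
    rintro z z' h ⟨⟨e1, e2, e3⟩, e4⟩
    exact ⟨⟨fun h' => e1 ((hR_out z z' h haT huT').2 h'), fun h' => e2 ((hR_out z z' h haT hcT).2 h'),
      fun h' => e3 ((hR_out z z' h huT' hcT).2 h')⟩, (hF_out z z' h).1 e4⟩
  -- rewrite the four sets of `H` through the network
  have ebad := Finset.filter_congr (s := (univ : Finset (α → Bool)))
    fun z _ => bad_iff_network ends u W hsep huW hs haW hau hcW z
  have ew := Finset.filter_congr (s := (univ : Finset (α → Bool)))
    fun z _ => w_iff_network ends u W hsep huW hs haW hcW z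
  have eP1 := Finset.filter_congr (s := (univ : Finset (α → Bool)))
    fun z _ => sa_iff_network ends u W hsep huW (c := c) hs haW z
  have eJ := Finset.filter_congr (s := (univ : Finset (α → Bool)))
    fun z _ => joined_iff_network ends u W hsep huW (c := c) hs haW z
  rw [ebad, ew, eP1, eJ, Finset.filter_or]
  have hdisj1 : Disjoint
      (univ.filter fun z : α → Bool => (openGraph (labelledOpen ends z)).Reachable u s ∧
        ((¬ (openGraph (labelledOpen ends z)).Reachable a u ∧ ¬ (openGraph (labelledOpen ends z)).Reachable a c ∧
            ¬ (openGraph (labelledOpen ends z)).Reachable u c) ∧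
          (openGraph (labelledOpen ends (clusterFlip ends a fun x => !z x))).Reachable u c))
      (univ.filter fun z : α → Bool => (¬ (openGraph (labelledOpen ends z)).Reachable u s ∧
          (openGraph (labelledOpen ends (clusterFlip ends u fun x => !z x))).Reachable u s) ∧
        (((openGraph (labelledOpen ends z)).Reachable a u ∧ ¬ (openGraph (labelledOpen ends z)).Reachable a c) ∧
          (openGraph (labelledOpen ends (clusterFlip ends a fun x => !z x))).Reachable u c)) := by
    rw [Finset.disjoint_filter]; intro z _ h1 h2; exact h2.1.1 h1.1
  rw [Finset.card_union_of_disjoint hdisj1]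
  -- independence counts
  have hI1 := card_and_mul_card_univ ins
    (fun z => (openGraph (labelledOpen ends z)).Reachable u s)
    (fun z => (¬ (openGraph (labelledOpen ends z)).Reachable a u ∧ ¬ (openGraph (labelledOpen ends z)).Reachable a c ∧
          ¬ (openGraph (labelledOpen ends z)).Reachable u c) ∧
        (openGraph (labelledOpen ends (clusterFlip ends a fun x => !z x))).Reachable u c)
    (fun z z' h hz => (hR_in z z' h).1 hz) hB_out
  have hI2 := card_and_mul_card_univ ins
    (fun z => ¬ (openGraph (labelledOpen ends z)).Reachable u s ∧
          (openGraph (labelledOpen ends (clusterFlip ends u fun x => !z x))).Reachable u s)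
    (fun z => ((openGraph (labelledOpen ends z)).Reachable a u ∧ ¬ (openGraph (labelledOpen ends z)).Reachable a c) ∧
          (openGraph (labelledOpen ends (clusterFlip ends a fun x => !z x))).Reachable u c)
    hV_in hWt_out
  have hI3 := card_and_mul_card_univ ins
    (fun z => (openGraph (labelledOpen ends z)).Reachable u s ∧
          (openGraph (labelledOpen ends (clusterFlip ends u fun x => !z x))).Reachable u s)
    (fun z => ((openGraph (labelledOpen ends z)).Reachable a u ∧ ¬ (openGraph (labelledOpen ends z)).Reachable a c) ∧
          (openGraph (labelledOpen ends (clusterFlip ends a fun x => !z x))).Reachable u c)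
    hA_in hWt_out
  have hI4 := card_and_mul_card_univ ins
    (fun z => (openGraph (labelledOpen ends z)).Reachable u s)
    (fun z => (openGraph (labelledOpen ends z)).Reachable a u ∧ ¬ (openGraph (labelledOpen ends z)).Reachable a c)
    (fun z z' h hz => (hR_in z z' h).1 hz)
    (by
      rintro z z' h ⟨e1, e2⟩
      exact ⟨(hR_out z z' h haT huT').1 e1, fun h' => e2 ((hR_out z z' h haT hcT).2 h')⟩)
  have hI5 := card_and_mul_card_univ ins
    (fun z => (openGraph (labelledOpen ends z)).Reachable u s)
    (fun z => (openGraph (labelledOpen ends z)).Reachable a u ∧ (openGraph (labelledOpen ends z)).Reachable a c)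
    (fun z z' h hz => (hR_in z z' h).1 hz)
    (by
      rintro z z' h ⟨e1, e2⟩
      exact ⟨(hR_out z z' h haT huT').1 e1, (hR_out z z' h haT hcT).1 e2⟩)
  beta_reduce at hI1 hI2 hI3 hI4 hI5
  -- `Vn + A = Cn` on the network side (via the A/Y lemma for the ambi count)
  have hVA' := card_virtual_add_card_ambi ends u s
  have hAY := card_filter_flat_eq_card_filter_compl ends u
    (fun z => (openGraph (labelledOpen ends z)).Reachable u s)
    (fun z => (openGraph (labelledOpen ends z)).Reachable u s)
    (fun z z' hz => by rw [hz s])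
  have hVA0 : (univ.filter fun z : α → Bool => ¬ (openGraph (labelledOpen ends z)).Reachable u s ∧
        (openGraph (labelledOpen ends (clusterFlip ends u fun x => !z x))).Reachable u s).card +
      (univ.filter fun z : α → Bool => (openGraph (labelledOpen ends z)).Reachable u s ∧
        (openGraph (labelledOpen ends (clusterFlip ends u fun x => !z x))).Reachable u s).card =
      (univ.filter fun z : α → Bool => (openGraph (labelledOpen ends z)).Reachable u s).card := by
    rw [hAY]; exact hVA'
  set U := (univ : Finset (α → Bool)).card with hU
  set Cn := (univ.filter fun z : α → Bool => (openGraph (labelledOpen ends z)).Reachable u s).card with hCn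
  set Vn := (univ.filter fun z : α → Bool => ¬ (openGraph (labelledOpen ends z)).Reachable u s ∧
      (openGraph (labelledOpen ends (clusterFlip ends u fun x => !z x))).Reachable u s).card with hVn
  set An := (univ.filter fun z : α → Bool => (openGraph (labelledOpen ends z)).Reachable u s ∧
      (openGraph (labelledOpen ends (clusterFlip ends u fun x => !z x))).Reachable u s).card with hAn
  set B := (univ.filter fun z : α → Bool =>
      (¬ (openGraph (labelledOpen ends z)).Reachable a u ∧ ¬ (openGraph (labelledOpen ends z)).Reachable a c ∧
          ¬ (openGraph (labelledOpen ends z)).Reachable u c) ∧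
        (openGraph (labelledOpen ends (clusterFlip ends a fun x => !z x))).Reachable u c).card with hB
  set Wt := (univ.filter fun z : α → Bool =>
      ((openGraph (labelledOpen ends z)).Reachable a u ∧ ¬ (openGraph (labelledOpen ends z)).Reachable a c) ∧
        (openGraph (labelledOpen ends (clusterFlip ends a fun x => !z x))).Reachable u c).card with hWt
  set Q1 := (univ.filter fun z : α → Bool =>
      (openGraph (labelledOpen ends z)).Reachable a u ∧ ¬ (openGraph (labelledOpen ends z)).Reachable a c).card with hQ1
  set J' := (univ.filter fun z : α → Bool =>
      (openGraph (labelledOpen ends z)).Reachable a u ∧ (openGraph (labelledOpen ends z)).Reachable a c).card with hJ'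
  set X1 := (univ.filter fun z : α → Bool => (openGraph (labelledOpen ends z)).Reachable u s ∧
      ((¬ (openGraph (labelledOpen ends z)).Reachable a u ∧ ¬ (openGraph (labelledOpen ends z)).Reachable a c ∧
          ¬ (openGraph (labelledOpen ends z)).Reachable u c) ∧
        (openGraph (labelledOpen ends (clusterFlip ends a fun x => !z x))).Reachable u c)).card with hX1
  set X2 := (univ.filter fun z : α → Bool => (¬ (openGraph (labelledOpen ends z)).Reachable u s ∧
        (openGraph (labelledOpen ends (clusterFlip ends u fun x => !z x))).Reachable u s) ∧
      (((openGraph (labelledOpen ends z)).Reachable a u ∧ ¬ (openGraph (labelledOpen ends z)).Reachable a c) ∧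
        (openGraph (labelledOpen ends (clusterFlip ends a fun x => !z x))).Reachable u c)).card with hX2
  set X3 := (univ.filter fun z : α → Bool => ((openGraph (labelledOpen ends z)).Reachable u s ∧
        (openGraph (labelledOpen ends (clusterFlip ends u fun x => !z x))).Reachable u s) ∧
      (((openGraph (labelledOpen ends z)).Reachable a u ∧ ¬ (openGraph (labelledOpen ends z)).Reachable a c) ∧
        (openGraph (labelledOpen ends (clusterFlip ends a fun x => !z x))).Reachable u c)).card with hX3
  set Y1 := (univ.filter fun z : α → Bool => (openGraph (labelledOpen ends z)).Reachable u s ∧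
      ((openGraph (labelledOpen ends z)).Reachable a u ∧ ¬ (openGraph (labelledOpen ends z)).Reachable a c)).card with hY1
  set Y2 := (univ.filter fun z : α → Bool => (openGraph (labelledOpen ends z)).Reachable u s ∧
      ((openGraph (labelledOpen ends z)).Reachable a u ∧ (openGraph (labelledOpen ends z)).Reachable a c)).card with hY2
  have hVA : Vn + An = Cn := hVA0
  have hUpos : 0 < U := Finset.card_pos.mpr Finset.univ_nonempty
  -- (X1 + X2 + X3)·U = Cn·B + Vn·Wt + An·Wt = Cn·(B + Wt)
  have hsum : (X1 + X2 + X3) * U = Cn * (B + Wt) := by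
    have : (X1 + X2 + X3) * U = X1 * U + X2 * U + X3 * U := by ring
    rw [this, hI1, hI2, hI3, ← hVA]; ring
  have key : ((X1 + X2 + X3) * U) ^ 2 ≤ (Y1 * U) * (Y2 * U) := by
    rw [hsum, hI4, hI5]
    calc (Cn * (B + Wt)) ^ 2 = Cn * Cn * (B + Wt) ^ 2 := by ring
      _ ≤ Cn * Cn * (Q1 * J') := Nat.mul_le_mul_left _ h
      _ = Cn * Q1 * (Cn * J') := by ring
  have key' : (X1 + X2 + X3) ^ 2 * (U * U) ≤ Y1 * Y2 * (U * U) := by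
    calc (X1 + X2 + X3) ^ 2 * (U * U) = ((X1 + X2 + X3) * U) ^ 2 := by ring
      _ ≤ (Y1 * U) * (Y2 * U) := key
      _ = Y1 * Y2 * (U * U) := by ring
  have hfin := Nat.le_of_mul_le_mul_right key' (Nat.mul_pos hUpos hUpos)
  -- the goal's left set is X1 + X2 (bad) + X3 (w)
  simpa only [add_assoc] using hfin

open Classical in
/-- **`(P)(H′) ∧ (S1J)(H′) ⟹ (P)(H)` across a terminal network.**  The pendant-label hypothesis of `productForm_of_terminalNetwork` follows from
`(S1J)` on the far side, since `#J′ ≤ 2·#P2′ + #J′`. [this work] -/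
theorem productForm_of_terminalNetwork_of_S1J (ends : α → Sym2 V) (u a s c : V) (W : Set V)
    (hsep : ∀ l : α, (∀ v ∈ ends l, v ∈ W ∨ v = u) ∨ (∀ v ∈ ends l, v ∉ W ∨ v = u))
    (huW : u ∉ W) (hs : s ∈ W) (haW : a ∉ W) (hau : a ≠ u) (hcW : c ∉ W) (hcu : c ≠ u)
    (h1 : (univ.filter fun z : α → Bool =>
        (¬ (openGraph (labelledOpen ends z)).Reachable a u ∧ ¬ (openGraph (labelledOpen ends z)).Reachable a c ∧
            ¬ (openGraph (labelledOpen ends z)).Reachable u c) ∧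
          (openGraph (labelledOpen ends (clusterFlip ends a fun x => !z x))).Reachable u c).card ^ 2 ≤
      (univ.filter fun z : α → Bool =>
        (openGraph (labelledOpen ends z)).Reachable a u ∧ ¬ (openGraph (labelledOpen ends z)).Reachable a c).card *
      (univ.filter fun z : α → Bool =>
        (openGraph (labelledOpen ends z)).Reachable a c ∧ ¬ (openGraph (labelledOpen ends z)).Reachable a u).card)
    (hS : ((univ.filter fun z : α → Bool =>
        (¬ (openGraph (labelledOpen ends z)).Reachable a u ∧ ¬ (openGraph (labelledOpen ends z)).Reachable a c ∧
            ¬ (openGraph (labelledOpen ends z)).Reachable u c) ∧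
          (openGraph (labelledOpen ends (clusterFlip ends a fun x => !z x))).Reachable u c).card +
        (univ.filter fun z : α → Bool =>
          ((openGraph (labelledOpen ends z)).Reachable a u ∧ ¬ (openGraph (labelledOpen ends z)).Reachable a c) ∧
            (openGraph (labelledOpen ends (clusterFlip ends a fun x => !z x))).Reachable u c).card) ^ 2 ≤
      (univ.filter fun z : α → Bool =>
        (openGraph (labelledOpen ends z)).Reachable a u ∧ ¬ (openGraph (labelledOpen ends z)).Reachable a c).card *
      (univ.filter fun z : α → Bool =>
        (openGraph (labelledOpen ends z)).Reachable a u ∧ (openGraph (labelledOpen ends z)).Reachable a c).card) :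
    (univ.filter fun z : α → Bool =>
        (¬ (openGraph (labelledOpen ends z)).Reachable a s ∧ ¬ (openGraph (labelledOpen ends z)).Reachable a c ∧
          ¬ (openGraph (labelledOpen ends z)).Reachable s c) ∧
        (openGraph (labelledOpen ends (clusterFlip ends a fun x => !z x))).Reachable s c).card ^ 2 ≤
    (univ.filter fun z : α → Bool =>
        (openGraph (labelledOpen ends z)).Reachable a s ∧ ¬ (openGraph (labelledOpen ends z)).Reachable a c).card *
    (univ.filter fun z : α → Bool =>
        (openGraph (labelledOpen ends z)).Reachable a c ∧ ¬ (openGraph (labelledOpen ends z)).Reachable a s).card := by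
  refine productForm_of_terminalNetwork ends u a s c W hsep huW hs haW hau hcW hcu h1 (le_trans hS (Nat.mul_le_mul_left _ ?_))
  have hJ : (univ.filter fun z : α → Bool =>
        (openGraph (labelledOpen ends z)).Reachable a u ∧ (openGraph (labelledOpen ends z)).Reachable a c) =
      (univ.filter fun z : α → Bool =>
        (openGraph (labelledOpen ends z)).Reachable a c ∧ (openGraph (labelledOpen ends z)).Reachable a u) :=
    Finset.filter_congr fun z _ => and_comm
  rw [hJ]; exact Nat.le_add_left _ _

end CountsS1J

end Summit.CriticalPhenomena.PercolationContinuityZ3.Theorems.ProductFormFibre
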